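import Summits.RiemannHypothesis.RiemannHypothesis.Theorems.JensenLogBandArcDescent
import HarnessLib

/-!
# Route JensenLogBand, BAND crux (stmt-RiemannHypothesis-19913) — infrastructure (S4)(0′):
# continuity of the saddle function and the INTEGRATED descent identity (RH-FREE)

Cell rh-jensen, LADDER-RH rung J-P(P3) «log band». Sequel of `JensenLogBandArcDescent` (p487066):
the saddle function `S_{n,c}(u) = γ̃′/γ̃(½+u) + 1/u − n/(u−c) − (n+1)/(u+c)` is continuous at every
admissible `u` (`γ̃` is analytic on `Re s > 0`, so `γ̃′` is continuous there), hence along any arc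
`t ↦ c + h e^{it}` staying in the admissible region the descent identity integrates:
`log‖I(φ)‖ − log‖I(φ₀)‖ = ∫_{φ₀}^{φ} Re( i(u(t)−c)·S_{n,c}(u(t)) ) dt` — the form consumed by the
global descent (S4)(i) together with the comparison lemma `sub_le_neg_mul_one_sub_cos`
(`JensenLogBandDescentCompare`).

WHAT THIS IS NOT: calculus on an explicit integrand; nothing here bears on zeros of `ζ` or the truth
of RH. (prover-rh-jensen-eng-2-g5-0, 2026-08-27.)
-/

noncomputable section

open Complex Metric Set

set_option linter.dupNamespace false

namespace Summit.RiemannHypothesis.RiemannHypothesis.Theorems.JensenPolynomials.LogBandArc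

open Literature.NumberTheory.LFunctions

/-- `γ̃′/γ̃` is continuous at every `s` with `Re s > 0`, `s ≠ 1` (`γ̃` is analytic on the open
right half-plane, so `γ̃′` is continuous; `γ̃ s ≠ 0`). RH-FREE. -/
theorem continuousAt_logDeriv_xiGammaFactor {s : ℂ} (hs : 0 < s.re) (hs1 : s ≠ 1) :
    ContinuousAt (logDeriv xiGammaFactor) s := by
  have hU : IsOpen {z : ℂ | 0 < z.re} := isOpen_lt continuous_const Complex.continuous_re
  have hdiff : DifferentiableOn ℂ xiGammaFactor {z : ℂ | 0 < z.re} :=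
    fun z hz => (differentiableAt_xiGammaFactor hz).differentiableWithinAt
  have han : AnalyticAt ℂ xiGammaFactor s := (hdiff.analyticOnNhd hU) s hs
  have hderiv : ContinuousAt (deriv xiGammaFactor) s := han.deriv.continuousAt
  have hcont : ContinuousAt xiGammaFactor s := (differentiableAt_xiGammaFactor hs).continuousAt
  have hne : xiGammaFactor s ≠ 0 := xiGammaFactor_ne_zero hs hs1
  have e : logDeriv xiGammaFactor = fun z => deriv xiGammaFactor z / xiGammaFactor z := by
    funext z; rw [logDeriv_apply]
  rw [e]
  exact hderiv.div hcont hne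

/-- The saddle function `S_{n,c}` is continuous at every admissible `u`
(`Re(½+u) > 0`, `½+u ≠ 1`, `u ≠ 0`, `u ≠ ±c`). RH-FREE. -/
theorem continuousAt_arcSaddleFn (n : ℕ) (c : ℂ) {u : ℂ} (hre : 0 < (1 / 2 + u).re)
    (h1 : 1 / 2 + u ≠ 1) (hu0 : u ≠ 0) (huc : u - c ≠ 0) (hupc : u + c ≠ 0) :
    ContinuousAt (fun w : ℂ => arcSaddleFn n c w) u := by
  have hL : ContinuousAt (fun w : ℂ => logDeriv xiGammaFactor (1 / 2 + w)) u :=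
    (continuousAt_logDeriv_xiGammaFactor hre h1).comp (continuousAt_const.add continuousAt_id)
  have h2 : ContinuousAt (fun w : ℂ => 1 / w) u := continuousAt_const.div continuousAt_id hu0
  have h3 : ContinuousAt (fun w : ℂ => (n : ℂ) / (w - c)) u :=
    continuousAt_const.div (continuousAt_id.sub continuousAt_const) huc
  have h4 : ContinuousAt (fun w : ℂ => ((n : ℂ) + 1) / (w + c)) u :=
    continuousAt_const.div (continuousAt_id.add continuousAt_const) hupc
  have h := ((hL.add h2).sub h3).sub h4
  refine h.congr (Filter.Eventually.of_forall fun w => ?_)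
  simp only [arcSaddleFn, Pi.add_apply, Pi.sub_apply]

/-- The descent density `t ↦ Re( i(u(t)−c)·S_{n,c}(u(t)) )`, `u(t) = c + h e^{it}`, is continuous at
every admissible angle. RH-FREE. -/
theorem continuousAt_descentDensity (n : ℕ) (h : ℝ) (c : ℂ) {t : ℝ}
    (hre : 0 < (1 / 2 + circleMap c h t).re) (h1 : 1 / 2 + circleMap c h t ≠ 1)
    (hu0 : circleMap c h t ≠ 0) (huc : circleMap c h t - c ≠ 0) (hupc : circleMap c h t + c ≠ 0) :
    ContinuousAt (fun s : ℝ => (I * (circleMap c h s - c) * arcSaddleFn n c (circleMap c h s)).re) t := by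
  have hcm : ContinuousAt (circleMap c h) t := (continuous_circleMap c h).continuousAt
  have hS : ContinuousAt (fun s : ℝ => arcSaddleFn n c (circleMap c h s)) t :=
    (continuousAt_arcSaddleFn n c hre h1 hu0 huc hupc).comp hcm
  have hprod : ContinuousAt (fun s : ℝ => I * (circleMap c h s - c) * arcSaddleFn n c (circleMap c h s)) t :=
    (continuousAt_const.mul (hcm.sub continuousAt_const)).mul hS
  exact Complex.continuous_re.continuousAt.comp hprod

/-- **The integrated descent identity:** if every angle between `φ₀` and `φ` is admissible
(`Re(½+u) > 0`, `½+u ≠ 1`, `u ≠ 0`, `u + c ≠ 0`; `h ≠ 0`), then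
`log‖I(φ)‖ − log‖I(φ₀)‖ = ∫_{φ₀}^{φ} Re( i(u(t)−c)·S_{n,c}(u(t)) ) dt` for the model integrand
`I = arcModelIntegrand n h c`. RH-FREE. -/
theorem log_norm_arcModelIntegrand_sub_eq_integral (n : ℕ) {h : ℝ} (hh : h ≠ 0) (c : ℂ)
    {φ₀ φ : ℝ}
    (hgood : ∀ t ∈ uIcc φ₀ φ, 0 < (1 / 2 + circleMap c h t).re ∧ 1 / 2 + circleMap c h t ≠ 1 ∧
      circleMap c h t ≠ 0 ∧ circleMap c h t + c ≠ 0) :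
    Real.log ‖arcModelIntegrand n h c φ‖ - Real.log ‖arcModelIntegrand n h c φ₀‖ =
      ∫ t in φ₀..φ, (I * (circleMap c h t - c) * arcSaddleFn n c (circleMap c h t)).re := by
  have hderiv : ∀ t ∈ uIcc φ₀ φ, HasDerivAt (fun θ : ℝ => Real.log ‖arcModelIntegrand n h c θ‖)
      ((I * (circleMap c h t - c) * arcSaddleFn n c (circleMap c h t)).re) t := by
    intro t ht
    obtain ⟨hre, h1, hu0, hupc⟩ := hgood t ht
    exact hasDerivAt_log_norm_arcModelIntegrand n hh c t hre h1 hu0 hupc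
  have hcont : ContinuousOn
      (fun t : ℝ => (I * (circleMap c h t - c) * arcSaddleFn n c (circleMap c h t)).re) (uIcc φ₀ φ) := by
    intro t ht
    obtain ⟨hre, h1, hu0, hupc⟩ := hgood t ht
    have huc : circleMap c h t - c ≠ 0 := sub_ne_zero.2 (circleMap_ne_center hh)
    exact (continuousAt_descentDensity n h c hre h1 hu0 huc hupc).continuousWithinAt
  have hint := hcont.intervalIntegrable (μ := MeasureTheory.volume)
  rw [intervalIntegral.integral_eq_sub_of_hasDerivAt hderiv hint]

end Summit.RiemannHypothesis.RiemannHypothesis.Theorems.JensenPolynomials.LogBandArc
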